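import Mathlib.Analysis.InnerProductSpace.Calculus
import Mathlib.Analysis.Calculus.Deriv.Inv
import Mathlib.Analysis.Calculus.Deriv.Pow
import Mathlib.Analysis.SpecialFunctions.Sqrt
import Literature.Geometry.Lorentzian.AsymptoticFlatness
import Literature.Geometry.Lorentzian.IsometryProofs
import Literature.Geometry.Lorentzian.ChartCalculus
import HarnessLib

/-!
# DR-strong asymptotic flatness implies asymptotic flatness of order one: discharge of
`AFEnd.IsStronglyAsymptoticallyFlatDR.IsAsymptoticallyFlat_one`

Companion ("Proofs") file of `Literature/Geometry/Lorentzian/AsymptoticFlatness.lean`. That file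
vendors, as the named fact `AFEnd.IsStronglyAsymptoticallyFlatDR.IsAsymptoticallyFlat_one e D`,
the implication: if the data `(h, k)` are strongly asymptotically flat with mass `M` on the end
`e` in the sense of Dafermos–Rodnianski (*Lectures on black holes and linear waves*, Clay Math.
Proc. 17 (2013), App. B.2.3 = arXiv:0811.0354, §11.2.3, p. 51:
`h_ab = (1 + 2M/r) δ_ab + o₂(r⁻¹)`, `k_ab = o₁(r⁻²)`), then they are asymptotically flat of order
`1` (`h - δ = O₂(r⁻¹)`, `k = O₁(r⁻²)`; Bartnik, CPAM 39 (1986), Def. 2.1). This file PROVES it: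
`AFEnd.IsStronglyAsymptoticallyFlatDR.IsAsymptoticallyFlat_one_holds`.

## Proof

In print this is the triangle inequality `h - δ = (h - (1 + 2M/r) δ) + (2M/r) δ` together with
`∂^m (1/r) = O(r^{-1-m})`. The vendored decay classes, however, are phrased with Mathlib's
`iteratedFDeriv ℝ m`, which takes the junk value `0` where a function is not differentiable, and
they carry no smoothness hypothesis on the chart components `hCoeff e D`; so
`iteratedFDeriv ℝ m (f + g)` need not be `iteratedFDeriv ℝ m f + iteratedFDeriv ℝ m g`. We prove
the fact as stated, for an *arbitrary* `f` and the smooth correction `g(y) = ‖y‖⁻¹ • c`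
(`isBigO_iteratedFDeriv_sub_of_isLittleO`, on any real inner product space):

* `m = 0`: pointwise triangle inequality.
* `m = 1` (`norm_fderiv_add_le_of_differentiableAt`): if `g` is differentiable at `x` then
  `‖D(f + g)(x)‖ ≤ ‖Df(x)‖ + ‖Dg(x)‖` — where `f` is not differentiable neither is `f + g`, and
  both sides involve the junk value `0`.
* `m = 2` (`norm_fderiv_fderiv_add_le_or`): if `g` is differentiable near `x` with `Dg`
  differentiable at `x`, then either `‖D²(f + g)(x)‖ ≤ ‖D²f(x)‖ + ‖D²g(x)‖`, or `‖Dg(x)‖` is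
  bounded by every local bound of `‖Df‖` near `x` (this alternative occurs only when `x` is a
  cluster point of both the differentiability and the non-differentiability set of `f`, where
  continuity of `D(f + g)` at `x` forces `Df → -Dg(x)` along points of differentiability). Along
  `Bornology.cobounded`, the second alternative is excluded for large `‖x‖` because
  `‖Df(y)‖ = o(‖y‖⁻²)` while `‖Dg(x)‖ = ‖c‖ ‖x‖⁻²` exactly (`norm_fderiv_inv_norm_smul`), unless
  `c = 0`, which is trivial.
* The derivatives of `y ↦ ‖y‖⁻¹` on a real inner product space (`hasFDerivAt_inv_norm`,
  `hasFDerivAt_fderiv_inv_norm`): `D(1/r) = -r⁻³ ⟨y, ·⟩`, `‖D(1/r)‖ = r⁻²`, `‖D²(1/r)‖ ≤ 4 r⁻³`.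

Implementation note: generic norm lemmas (`norm_zero`, `norm_nonneg`, `norm_norm`) do not
rewrite operator norms of *iterated* spaces `E →L[ℝ] E →L[ℝ] V` by unification in this Mathlib,
so such steps are done with explicitly instantiated terms or `positivity`.

## Smoothness of the chart components `h_ij`, `k_ij` (`AFEnd.ContDiffOn_hCoeff/kCoeff`)

The same prelude file vendors, as the named facts `AFEnd.ContDiffOn_hCoeff e D` and
`AFEnd.ContDiffOn_kCoeff e D`, that the chart components `h_ij = (Φ^* h)_ij` of the metric and
`k_ij = (Φ^* k)_ij` of the second fundamental form (`AFEnd.hCoeff`, `AFEnd.kCoeff`: the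
pullbacks along the inverse chart `Φ = e.dataChart` of the end) are `C^∞` on the open exterior
region `{R < ‖x‖}` (Bartnik, CPAM 39 (1986), §1, p. 662: the exterior domain `E_R = ℝⁿ ∖ B_R`;
Def. 2.1, p. 675: a structure of infinity is a `C^∞` diffeomorphism `Φ : M ∖ K → E_R`, the
metric being read through its components `(Φ_* g)_ij` on `E_R`; Christodoulou–Klainerman 1993,
§1, (1.0.9): `g_ij`, `k_ij` in a coordinate system defined in a neighbourhood of infinity). This
file PROVES both (`AFEnd.ContDiffOn_hCoeff_holds`, `AFEnd.ContDiffOn_kCoeff_holds`): the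
pullback of a `C^∞` field of bilinear forms along the `C^∞` map `Φ` is a `C^∞` section of the
bundle of bilinear forms over the open submanifold `exteriorRegion e.R ⊆ E3`
(`PseudoRiemannianMetric.contMDiff_pullbackBilin_holds` of `IsometryProofs.lean` for the metric,
and its verbatim generalisation `contMDiff_pullbackBilin_of_contMDiff` to an arbitrary smooth
section, proved here, for `k`; O'Neill 1983, Ch. 3, Def. 3.9), and over an open subset of the
model space that bundle is trivialised by the identity, so that a section is `C^∞` iff its
representative `E3 → (E3 →L E3 →L ℝ)` — here `hCoeff e D`, resp. `kCoeff e D`, itself — is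
(`OpensChart.contMDiffAt_bilinSection_iff`, file `ChartCalculus.lean`).

## References

* M. Dafermos, I. Rodnianski, *Lectures on black holes and linear waves*, Clay Math. Proc. 17
  (2013), App. B.2.3; arXiv:0811.0354, §11.2.3 (p. 51). [DafermosRodnianski2013]
* R. Bartnik, *The mass of an asymptotically flat manifold*, CPAM 39 (1986), §1 (p. 662) and
  Def. 2.1 (p. 675). [Bartnik1986]
* D. Christodoulou, S. Klainerman, *The global nonlinear stability of the Minkowski space*,
  Princeton Math. Series 41 (1993), §1, (1.0.9). [ChristodoulouKlainerman1993]
* B. O'Neill, *Semi-Riemannian geometry with applications to relativity*, Academic Press 1983,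
  Ch. 3, Def. 3.9 (pullback of covariant tensors). [ONeill1983]
-/

open Filter Asymptotics Bornology Topology ContinuousLinearMap
open scoped RealInnerProductSpace Manifold ContDiff

noncomputable section

namespace Literature.Geometry.Lorentzian

/-! ### Junk-robust subadditivity of first and second derivatives -/

section Junk

variable {E V : Type*} [NormedAddCommGroup E] [NormedSpace ℝ E] [NormedAddCommGroup V]
  [NormedSpace ℝ V]

/-- **Subadditivity of the (junk-valued) derivative.** If `g` is differentiable at `x` then
`‖D(f + g)(x)‖ ≤ ‖Df(x)‖ + ‖Dg(x)‖` for Mathlib's `fderiv` (junk value `0` where not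
differentiable): where `f` is differentiable this is `fderiv_add`, elsewhere `f + g` is not
differentiable either and the left-hand side is `0`. [folklore] -/
theorem norm_fderiv_add_le_of_differentiableAt {f g : E → V} {x : E}
    (hg : DifferentiableAt ℝ g x) :
    ‖fderiv ℝ (f + g) x‖ ≤ ‖fderiv ℝ f x‖ + ‖fderiv ℝ g x‖ := by
  by_cases hf : DifferentiableAt ℝ f x
  · rw [fderiv_add hf hg]
    exact norm_add_le _ _
  · have hfg : ¬DifferentiableAt ℝ (f + g) x := fun h ↦ hf (by simpa using h.sub hg)
    rw [fderiv_zero_of_not_differentiableAt hfg, norm_zero]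
    positivity

/-- **Subadditivity of the (junk-valued) second derivative, up to an exceptional alternative.**
Let `g` be differentiable near `x` with `Dg` differentiable at `x`, and `f` arbitrary. Then
either `‖D²(f + g)(x)‖ ≤ ‖D²f(x)‖ + ‖D²g(x)‖` (Mathlib's `fderiv ∘ fderiv`, junk values `0`), or
`‖Dg(x)‖ ≤ C` for every local bound `C` of `‖Df‖` near `x`. The second alternative is what
remains when `x` is a cluster point both of points where `f` is differentiable and of points
where it is not, and `D(f + g)` is nevertheless differentiable (hence continuous) at `x`: then
`D(f + g)(x) = 0` and `Df(y) + Dg(y) → 0` along the points of differentiability. [folklore] -/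
theorem norm_fderiv_fderiv_add_le_or {f g : E → V} {x : E}
    (hg1 : ∀ᶠ y in 𝓝 x, DifferentiableAt ℝ g y) (hg2 : DifferentiableAt ℝ (fderiv ℝ g) x) :
    ‖fderiv ℝ (fderiv ℝ (f + g)) x‖ ≤
        ‖fderiv ℝ (fderiv ℝ f) x‖ + ‖fderiv ℝ (fderiv ℝ g) x‖ ∨
      ∀ C : ℝ, (∀ᶠ y in 𝓝 x, ‖fderiv ℝ f y‖ ≤ C) → ‖fderiv ℝ g x‖ ≤ C := by
  -- where `g` is differentiable and `f` is not, `D(f + g) = 0`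
  have key : ∀ y, DifferentiableAt ℝ g y → ¬DifferentiableAt ℝ f y → fderiv ℝ (f + g) y = 0 :=
    fun y hgy hfy ↦ fderiv_zero_of_not_differentiableAt fun h ↦ hfy (by simpa using h.sub hgy)
  have hnn : (0 : ℝ) ≤ ‖fderiv ℝ (fderiv ℝ f) x‖ + ‖fderiv ℝ (fderiv ℝ g) x‖ := by positivity
  by_cases hA : DifferentiableAt ℝ (fderiv ℝ (f + g)) x
  swap
  · left
    rw [fderiv_zero_of_not_differentiableAt hA]
    exact (@norm_zero (E →L[ℝ] E →L[ℝ] V) _).le.trans hnn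
  by_cases hB1 : ∀ᶠ y in 𝓝 x, DifferentiableAt ℝ f y
  · -- `f` differentiable near `x`: `D(f + g) = Df + Dg` near `x`
    left
    have heq : fderiv ℝ (f + g) =ᶠ[𝓝 x] fderiv ℝ f + fderiv ℝ g := by
      filter_upwards [hB1, hg1] with y hfy hgy
      rw [Pi.add_apply, fderiv_add hfy hgy]
    rw [heq.fderiv_eq]
    exact norm_fderiv_add_le_of_differentiableAt hg2
  by_cases hB2 : ∀ᶠ y in 𝓝 x, ¬DifferentiableAt ℝ f y
  · -- `f` nowhere differentiable near `x`: `D(f + g) = 0` near `x`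
    left
    have heq : fderiv ℝ (f + g) =ᶠ[𝓝 x] fun _ ↦ 0 := by
      filter_upwards [hB2, hg1] with y hfy hgy
      exact key y hgy hfy
    have h0 : fderiv ℝ (fderiv ℝ (f + g)) x = 0 := by
      rw [heq.fderiv_eq, fderiv_fun_const, Pi.zero_apply]
    rw [h0]
    exact (@norm_zero (E →L[ℝ] E →L[ℝ] V) _).le.trans hnn
  -- the exceptional alternative
  right
  rw [not_eventually] at hB1 hB2
  simp only [not_not] at hB2
  have hcont : ContinuousAt (fderiv ℝ (f + g)) x := hA.continuousAt
  have hgx : DifferentiableAt ℝ g x := hg1.self_of_nhds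
  intro C hC
  by_cases hx : DifferentiableAt ℝ f x
  · have h0 : fderiv ℝ (f + g) x = 0 := by
      by_contra h
      obtain ⟨y, hfy, hne, hgy⟩ := (hB1.and_eventually ((hcont.eventually_ne h).and hg1)).exists
      exact hne (key y hgy hfy)
    rw [fderiv_add hx hgx] at h0
    rw [eq_neg_of_add_eq_zero_right h0, norm_neg]
    exact hC.self_of_nhds
  · have h0 : fderiv ℝ (f + g) x = 0 := key x hgx hx
    have hT : Tendsto (fderiv ℝ (f + g)) (𝓝 x) (𝓝 (fderiv ℝ (f + g) x)) := hcont.tendsto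
    rw [h0] at hT
    have hTg : Tendsto (fderiv ℝ g) (𝓝 x) (𝓝 (fderiv ℝ g x)) := hg2.continuousAt.tendsto
    refine le_of_forall_pos_le_add fun η hη ↦ ?_
    have e1 : ∀ᶠ y in 𝓝 x, dist (fderiv ℝ (f + g) y) 0 < η / 2 :=
      (Metric.tendsto_nhds.1 hT) (η / 2) (half_pos hη)
    have e2 : ∀ᶠ y in 𝓝 x, dist (fderiv ℝ g y) (fderiv ℝ g x) < η / 2 :=
      (Metric.tendsto_nhds.1 hTg) (η / 2) (half_pos hη)
    obtain ⟨y, hfy, hy1, hy2, hyC, hgy⟩ :=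
      (hB2.and_eventually (e1.and (e2.and (hC.and hg1)))).exists
    rw [dist_zero_right] at hy1
    rw [dist_eq_norm] at hy2
    have hadd : fderiv ℝ (f + g) y = fderiv ℝ f y + fderiv ℝ g y := fderiv_add hfy hgy
    calc ‖fderiv ℝ g x‖
        = ‖(fderiv ℝ (f + g) y - fderiv ℝ f y) - (fderiv ℝ g y - fderiv ℝ g x)‖ := by
          rw [hadd]; congr 1; abel
      _ ≤ ‖fderiv ℝ (f + g) y‖ + ‖fderiv ℝ f y‖ + ‖fderiv ℝ g y - fderiv ℝ g x‖ :=
          (norm_sub_le _ _).trans (by gcongr; exact norm_sub_le _ _)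
      _ ≤ η / 2 + C + η / 2 := by gcongr
      _ = C + η := by ring

end Junk

/-! ### Derivatives of `y ↦ ‖y‖⁻¹` on a real inner product space -/

section InvNorm

variable {E : Type*} [NormedAddCommGroup E] [InnerProductSpace ℝ E]

/-- The derivative of the norm of a real inner product space away from the origin:
`D‖·‖(x) = ‖x‖⁻¹ ⟨x, ·⟩`. [folklore] -/
theorem hasFDerivAt_norm_of_ne_zero {x : E} (hx : x ≠ 0) :
    HasFDerivAt (fun y : E ↦ ‖y‖) (‖x‖⁻¹ • (innerSL ℝ x : E →L[ℝ] ℝ)) x := by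
  have h1 : HasFDerivAt (fun y : E ↦ ‖y‖ ^ 2) (2 • (innerSL ℝ x : E →L[ℝ] ℝ)) x :=
    (hasStrictFDerivAt_norm_sq x).hasFDerivAt
  have hx2 : ‖x‖ ^ 2 ≠ 0 := by positivity
  have h3 : HasFDerivAt (fun y : E ↦ Real.sqrt (‖y‖ ^ 2))
      ((1 / (2 * Real.sqrt (‖x‖ ^ 2))) • (2 • (innerSL ℝ x : E →L[ℝ] ℝ))) x :=
    (Real.hasDerivAt_sqrt hx2).comp_hasFDerivAt x h1
  simp only [Real.sqrt_sq_eq_abs, abs_norm] at h3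
  refine h3.congr_fderiv ?_
  have hx' : ‖x‖ ≠ 0 := norm_ne_zero_iff.2 hx
  rw [← Nat.cast_smul_eq_nsmul ℝ, smul_smul]
  congr 1
  push_cast
  field_simp

/-- The derivative of `y ↦ ‖y‖⁻¹` away from the origin: `D(‖·‖⁻¹)(x) = -‖x‖⁻³ ⟨x, ·⟩`.
[folklore] -/
theorem hasFDerivAt_inv_norm {x : E} (hx : x ≠ 0) :
    HasFDerivAt (fun y : E ↦ ‖y‖⁻¹) ((-(‖x‖ ^ 3)⁻¹) • (innerSL ℝ x : E →L[ℝ] ℝ)) x := by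
  have hx' : ‖x‖ ≠ 0 := norm_ne_zero_iff.2 hx
  have h : HasFDerivAt (fun y : E ↦ ‖y‖⁻¹)
      ((-(‖x‖ ^ 2)⁻¹) • (‖x‖⁻¹ • (innerSL ℝ x : E →L[ℝ] ℝ))) x :=
    (hasDerivAt_inv hx').comp_hasFDerivAt x (hasFDerivAt_norm_of_ne_zero hx)
  refine h.congr_fderiv ?_
  rw [smul_smul]
  congr 1
  field_simp

/-- `‖D(‖·‖⁻¹)(x)‖ = ‖x‖⁻²` for `x ≠ 0`. [folklore] -/
theorem norm_fderiv_inv_norm {x : E} (hx : x ≠ 0) :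
    ‖fderiv ℝ (fun y : E ↦ ‖y‖⁻¹) x‖ = (‖x‖ ^ 2)⁻¹ := by
  have hx' : ‖x‖ ≠ 0 := norm_ne_zero_iff.2 hx
  rw [(hasFDerivAt_inv_norm hx).fderiv, norm_smul, Real.norm_eq_abs, abs_neg, abs_inv, abs_pow,
    abs_norm, innerSL_apply_norm]
  field_simp

/-- `y ↦ ‖y‖⁻¹` is differentiable away from the origin. [folklore] -/
theorem differentiableAt_inv_norm {x : E} (hx : x ≠ 0) :
    DifferentiableAt ℝ (fun y : E ↦ ‖y‖⁻¹) x :=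
  (hasFDerivAt_inv_norm hx).differentiableAt

/-- **The second derivative of `y ↦ ‖y‖⁻¹`** away from the origin, as the derivative of the
operator-valued map `y ↦ D(‖·‖⁻¹)(y) = -‖y‖⁻³ ⟨y, ·⟩`:
`D²(‖·‖⁻¹)(x) = -‖x‖⁻³ ⟨·, ·⟩ + 3 ‖x‖⁻⁵ ⟨x, ·⟩ ⟨x, ·⟩`. [folklore] -/
theorem hasFDerivAt_fderiv_inv_norm {x : E} (hx : x ≠ 0) :
    HasFDerivAt (fderiv ℝ fun y : E ↦ ‖y‖⁻¹)
      ((-(‖x‖ ^ 3)⁻¹) • (innerSL ℝ : E →L[ℝ] E →L[ℝ] ℝ) +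
        ((3 * ‖x‖ ^ 2 / (‖x‖ ^ 3) ^ 2) • (‖x‖⁻¹ • (innerSL ℝ x : E →L[ℝ] ℝ))).smulRight
          (innerSL ℝ x : E →L[ℝ] ℝ)) x := by
  have hx' : ‖x‖ ≠ 0 := norm_ne_zero_iff.2 hx
  -- near `x` the derivative is `y ↦ -‖y‖⁻³ ⟨y, ·⟩`
  have heq : (fun y : E ↦ (-(‖y‖ ^ 3)⁻¹) • (innerSL ℝ y : E →L[ℝ] ℝ)) =ᶠ[𝓝 x]
      fderiv ℝ fun y : E ↦ ‖y‖⁻¹ := by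
    filter_upwards [eventually_ne_nhds hx] with y hy
    exact (hasFDerivAt_inv_norm hy).fderiv.symm
  refine HasFDerivAt.congr_of_eventuallyEq ?_ heq.symm
  have hs : HasFDerivAt (fun y : E ↦ -(‖y‖ ^ 3)⁻¹)
      ((3 * ‖x‖ ^ 2 / (‖x‖ ^ 3) ^ 2) • (‖x‖⁻¹ • (innerSL ℝ x : E →L[ℝ] ℝ))) x := by
    have h1 : HasDerivAt (fun r : ℝ ↦ -(r ^ 3)⁻¹) (3 * ‖x‖ ^ 2 / (‖x‖ ^ 3) ^ 2) ‖x‖ := by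
      have := ((hasDerivAt_pow 3 ‖x‖).fun_inv (pow_ne_zero 3 hx')).fun_neg
      refine this.congr_deriv ?_
      push_cast
      ring
    exact h1.comp_hasFDerivAt x (hasFDerivAt_norm_of_ne_zero hx)
  have hT : HasFDerivAt (fun y : E ↦ (innerSL ℝ y : E →L[ℝ] ℝ))
      (innerSL ℝ : E →L[ℝ] E →L[ℝ] ℝ) x :=
    (innerSL ℝ : E →L[ℝ] E →L[ℝ] ℝ).hasFDerivAt
  exact hs.smul hT

/-- `D(‖·‖⁻¹)` is differentiable away from the origin. [folklore] -/
theorem differentiableAt_fderiv_inv_norm {x : E} (hx : x ≠ 0) :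
    DifferentiableAt ℝ (fderiv ℝ fun y : E ↦ ‖y‖⁻¹) x :=
  (hasFDerivAt_fderiv_inv_norm hx).differentiableAt

/-- `‖D²(‖·‖⁻¹)(x)‖ ≤ 4 ‖x‖⁻³` for `x ≠ 0`. [folklore] -/
theorem norm_fderiv_fderiv_inv_norm_le {x : E} (hx : x ≠ 0) :
    ‖fderiv ℝ (fderiv ℝ fun y : E ↦ ‖y‖⁻¹) x‖ ≤ 4 * (‖x‖ ^ 3)⁻¹ := by
  have hx' : ‖x‖ ≠ 0 := norm_ne_zero_iff.2 hx
  have hpos : 0 < ‖x‖ := norm_pos_iff.2 hx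
  rw [(hasFDerivAt_fderiv_inv_norm hx).fderiv]
  set A : E →L[ℝ] E →L[ℝ] ℝ := (-(‖x‖ ^ 3)⁻¹) • (innerSL ℝ : E →L[ℝ] E →L[ℝ] ℝ) with hA
  set B : E →L[ℝ] E →L[ℝ] ℝ :=
    ((3 * ‖x‖ ^ 2 / (‖x‖ ^ 3) ^ 2) • (‖x‖⁻¹ • (innerSL ℝ x : E →L[ℝ] ℝ))).smulRight
      (innerSL ℝ x : E →L[ℝ] ℝ) with hB
  have h1 : ‖A‖ ≤ (‖x‖ ^ 3)⁻¹ := by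
    refine opNorm_le_bound A (by positivity) fun y ↦ ?_
    have hAy : A y = (-(‖x‖ ^ 3)⁻¹) • (innerSL ℝ y : E →L[ℝ] ℝ) := rfl
    rw [hAy, norm_smul, Real.norm_eq_abs, abs_neg, abs_inv, abs_pow, abs_norm, innerSL_apply_norm]
  have h2 : ‖B‖ ≤ 3 * (‖x‖ ^ 3)⁻¹ := by
    rw [hB, norm_smulRight_apply, norm_smul, norm_smul, Real.norm_eq_abs, Real.norm_eq_abs,
      abs_inv, abs_norm, innerSL_apply_norm, abs_of_nonneg (by positivity)]
    apply le_of_eq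
    field_simp
  calc ‖A + B‖ ≤ ‖A‖ + ‖B‖ := norm_add_le A B
    _ ≤ (‖x‖ ^ 3)⁻¹ + 3 * (‖x‖ ^ 3)⁻¹ := add_le_add h1 h2
    _ = 4 * (‖x‖ ^ 3)⁻¹ := by ring

variable {V : Type*} [NormedAddCommGroup V] [NormedSpace ℝ V]

/-- The derivative of `y ↦ ‖y‖⁻¹ • c` away from the origin is `D(‖·‖⁻¹)(x) ⊗ c`. [folklore] -/
theorem hasFDerivAt_inv_norm_smul (c : V) {x : E} (hx : x ≠ 0) :
    HasFDerivAt (fun y : E ↦ ‖y‖⁻¹ • c) ((fderiv ℝ (fun y : E ↦ ‖y‖⁻¹) x).smulRight c) x :=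
  (differentiableAt_inv_norm hx).hasFDerivAt.smul_const c

/-- `y ↦ ‖y‖⁻¹ • c` is differentiable away from the origin. [folklore] -/
theorem differentiableAt_inv_norm_smul (c : V) {x : E} (hx : x ≠ 0) :
    DifferentiableAt ℝ (fun y : E ↦ ‖y‖⁻¹ • c) x :=
  (hasFDerivAt_inv_norm_smul c hx).differentiableAt

/-- `‖D(‖·‖⁻¹ • c)(x)‖ = ‖c‖ ‖x‖⁻²` for `x ≠ 0` (exactly; this lower bound is what excludes the
exceptional alternative of `norm_fderiv_fderiv_add_le_or` at infinity). [folklore] -/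
theorem norm_fderiv_inv_norm_smul (c : V) {x : E} (hx : x ≠ 0) :
    ‖fderiv ℝ (fun y : E ↦ ‖y‖⁻¹ • c) x‖ = ‖c‖ * (‖x‖ ^ 2)⁻¹ := by
  rw [(hasFDerivAt_inv_norm_smul c hx).fderiv, norm_smulRight_apply, norm_fderiv_inv_norm hx,
    mul_comm]

/-- Near a point `x ≠ 0`, `D(‖·‖⁻¹ • c) = Λ_c ∘ D(‖·‖⁻¹)` with `Λ_c ℓ = ℓ ⊗ c` the continuous
linear map `(smulRightL ℝ E V).flip c`. [folklore] -/
theorem fderiv_inv_norm_smul_eventuallyEq (c : V) {x : E} (hx : x ≠ 0) :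
    fderiv ℝ (fun y : E ↦ ‖y‖⁻¹ • c) =ᶠ[𝓝 x]
      fun y ↦ (smulRightL ℝ E V).flip c (fderiv ℝ (fun y : E ↦ ‖y‖⁻¹) y) := by
  filter_upwards [eventually_ne_nhds hx] with y hy
  rw [(hasFDerivAt_inv_norm_smul c hy).fderiv]
  rfl

/-- The second derivative of `y ↦ ‖y‖⁻¹ • c` away from the origin is
`Λ_c ∘ D²(‖·‖⁻¹)(x)`. [folklore] -/
theorem hasFDerivAt_fderiv_inv_norm_smul (c : V) {x : E} (hx : x ≠ 0) :
    HasFDerivAt (fderiv ℝ fun y : E ↦ ‖y‖⁻¹ • c)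
      (((smulRightL ℝ E V).flip c).comp (fderiv ℝ (fderiv ℝ fun y : E ↦ ‖y‖⁻¹) x)) x := by
  refine HasFDerivAt.congr_of_eventuallyEq ?_ (fderiv_inv_norm_smul_eventuallyEq c hx)
  exact ((smulRightL ℝ E V).flip c).hasFDerivAt.comp x
    (differentiableAt_fderiv_inv_norm hx).hasFDerivAt

/-- `D(‖·‖⁻¹ • c)` is differentiable away from the origin. [folklore] -/
theorem differentiableAt_fderiv_inv_norm_smul (c : V) {x : E} (hx : x ≠ 0) :
    DifferentiableAt ℝ (fderiv ℝ fun y : E ↦ ‖y‖⁻¹ • c) x :=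
  (hasFDerivAt_fderiv_inv_norm_smul c hx).differentiableAt

/-- `‖D²(‖·‖⁻¹ • c)(x)‖ ≤ 4 ‖c‖ ‖x‖⁻³` for `x ≠ 0`. [folklore] -/
theorem norm_fderiv_fderiv_inv_norm_smul_le (c : V) {x : E} (hx : x ≠ 0) :
    ‖fderiv ℝ (fderiv ℝ fun y : E ↦ ‖y‖⁻¹ • c) x‖ ≤ 4 * ‖c‖ * (‖x‖ ^ 3)⁻¹ := by
  rw [(hasFDerivAt_fderiv_inv_norm_smul c hx).fderiv]
  refine (opNorm_comp_le _ _).trans ?_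
  have hΛ : ‖(smulRightL ℝ E V).flip c‖ ≤ ‖c‖ := by
    refine opNorm_le_bound _ (norm_nonneg c) fun ℓ ↦ ?_
    rw [flip_apply]
    change ‖ℓ.smulRight c‖ ≤ ‖c‖ * ‖ℓ‖
    rw [norm_smulRight_apply, mul_comm]
  calc ‖(smulRightL ℝ E V).flip c‖ * ‖fderiv ℝ (fderiv ℝ fun y : E ↦ ‖y‖⁻¹) x‖
      ≤ ‖c‖ * (4 * (‖x‖ ^ 3)⁻¹) :=
        mul_le_mul hΛ (norm_fderiv_fderiv_inv_norm_le hx)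
          (norm_nonneg (fderiv ℝ (fderiv ℝ fun y : E ↦ ‖y‖⁻¹) x)) (norm_nonneg c)
    _ = 4 * ‖c‖ * (‖x‖ ^ 3)⁻¹ := by ring

/-! ### Asymptotics of `f + ‖·‖⁻¹ • c` at infinity for a junk-differentiated `f` -/

omit [InnerProductSpace ℝ E] in
/-- `‖f + ‖·‖⁻¹ • c‖ = O(r⁻¹)` at infinity if `‖f‖ = o(r⁻¹)`. [folklore] -/
theorem isBigO_add_inv_norm_smul {f : E → V} (c : V)
    (h0 : (fun x ↦ ‖f x‖) =o[cobounded E] fun x ↦ ‖x‖⁻¹) :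
    (fun x ↦ ‖(f + fun y ↦ ‖y‖⁻¹ • c : E → V) x‖) =O[cobounded E] fun x ↦ ‖x‖⁻¹ := by
  have hg : (fun x : E ↦ ‖x‖⁻¹ • c) =O[cobounded E] fun x ↦ ‖x‖⁻¹ := by
    refine IsBigO.of_bound ‖c‖ (Eventually.of_forall fun x ↦ ?_)
    rw [norm_smul, norm_inv, norm_norm, mul_comm]
  exact (h0.isBigO.of_norm_left.add hg).norm_left

/-- `‖D(f + ‖·‖⁻¹ • c)‖ = O(r⁻²)` at infinity if `‖Df‖ = o(r⁻²)` (junk-valued derivatives).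
[folklore] -/
theorem isBigO_fderiv_add_inv_norm_smul {f : E → V} (c : V)
    (h1 : (fun x ↦ ‖fderiv ℝ f x‖) =o[cobounded E] fun x ↦ (‖x‖ ^ 2)⁻¹) :
    (fun x ↦ ‖fderiv ℝ (f + fun y ↦ ‖y‖⁻¹ • c) x‖) =O[cobounded E] fun x ↦ (‖x‖ ^ 2)⁻¹ := by
  have hne : ∀ᶠ x in cobounded E, x ≠ 0 := by
    filter_upwards [eventually_cobounded_le_norm (E := E) 1] with x hx
    rintro rfl
    rw [norm_zero] at hx
    exact not_lt.2 hx one_pos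
  have hgO : (fun x ↦ ‖fderiv ℝ (fun y : E ↦ ‖y‖⁻¹ • c) x‖) =O[cobounded E]
      fun x ↦ (‖x‖ ^ 2)⁻¹ := by
    refine ((IsBigO.of_norm_eventuallyLE (g := fun x : E ↦ ‖c‖ * (‖x‖ ^ 2)⁻¹) ?_).trans
      (isBigO_const_mul_self ‖c‖ _ _)).norm_left
    filter_upwards [hne] with x hx
    exact (norm_fderiv_inv_norm_smul c hx).le
  have H : ∀ᶠ x in cobounded E, ‖fderiv ℝ (f + fun y : E ↦ ‖y‖⁻¹ • c) x‖ ≤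
      ‖fderiv ℝ f x‖ + ‖fderiv ℝ (fun y : E ↦ ‖y‖⁻¹ • c) x‖ := by
    filter_upwards [hne] with x hx
    exact norm_fderiv_add_le_of_differentiableAt (differentiableAt_inv_norm_smul c hx)
  exact ((IsBigO.of_norm_eventuallyLE H).trans (h1.isBigO.add hgO)).norm_left

/-- **`o₂ + c/r = O₂` at second order, for junk-valued derivatives.** If `‖Df‖ = o(r⁻²)` and
`‖D²f‖ = o(r⁻³)` at infinity (Mathlib's `fderiv`, `fderiv ∘ fderiv`, junk value `0`), then
`‖D²(f + ‖·‖⁻¹ • c)‖ = O(r⁻³)` at infinity. [folklore] -/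
theorem isBigO_fderiv_fderiv_add_inv_norm_smul {f : E → V} (c : V)
    (h1 : (fun x ↦ ‖fderiv ℝ f x‖) =o[cobounded E] fun x ↦ (‖x‖ ^ 2)⁻¹)
    (h2 : (fun x ↦ ‖fderiv ℝ (fderiv ℝ f) x‖) =o[cobounded E] fun x ↦ (‖x‖ ^ 3)⁻¹) :
    (fun x ↦ ‖fderiv ℝ (fderiv ℝ (f + fun y ↦ ‖y‖⁻¹ • c)) x‖) =O[cobounded E]
      fun x ↦ (‖x‖ ^ 3)⁻¹ := by
  have hne : ∀ᶠ x in cobounded E, x ≠ 0 := by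
    filter_upwards [eventually_cobounded_le_norm (E := E) 1] with x hx
    rintro rfl
    rw [norm_zero] at hx
    exact not_lt.2 hx one_pos
  -- the second derivative of `g = ‖·‖⁻¹ • c`
  have hgO : (fun x ↦ ‖fderiv ℝ (fderiv ℝ fun y : E ↦ ‖y‖⁻¹ • c) x‖) =O[cobounded E]
      fun x ↦ (‖x‖ ^ 3)⁻¹ := by
    refine IsBigO.of_bound (4 * ‖c‖) ?_
    filter_upwards [hne] with x hx
    rw [Real.norm_of_nonneg (norm_nonneg (fderiv ℝ (fderiv ℝ fun y : E ↦ ‖y‖⁻¹ • c) x)),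
      Real.norm_of_nonneg (by positivity)]
    exact norm_fderiv_fderiv_inv_norm_smul_le c hx
  -- the eventual pointwise bound
  suffices H : ∀ᶠ x in cobounded E, ‖fderiv ℝ (fderiv ℝ (f + fun y : E ↦ ‖y‖⁻¹ • c)) x‖ ≤
      ‖fderiv ℝ (fderiv ℝ f) x‖ + ‖fderiv ℝ (fderiv ℝ fun y : E ↦ ‖y‖⁻¹ • c) x‖ by
    refine IsBigO.trans (IsBigO.of_bound' ?_) (h2.isBigO.add hgO)
    filter_upwards [H] with x hx
    rwa [Real.norm_of_nonneg (norm_nonneg (fderiv ℝ (fderiv ℝ (f + fun y : E ↦ ‖y‖⁻¹ • c)) x)),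
      Real.norm_of_nonneg (by positivity)]
  by_cases hc : c = 0
  · -- `c = 0`: `g = 0`
    have hg0 : (fun y : E ↦ ‖y‖⁻¹ • c) = 0 := by
      funext y
      simp [hc]
    refine Eventually.of_forall fun x ↦ ?_
    rw [hg0, add_zero]
    exact le_add_of_nonneg_right (by positivity)
  -- `c ≠ 0`: the exceptional alternative is excluded at infinity
  have hc' : 0 < ‖c‖ := norm_pos_iff.2 hc
  have h1' : ∀ᶠ y in cobounded E, ‖fderiv ℝ f y‖ ≤ ‖c‖ / 8 * (‖y‖ ^ 2)⁻¹ := by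
    filter_upwards [h1.def (by positivity : (0 : ℝ) < ‖c‖ / 8)] with y hy
    rwa [norm_norm, Real.norm_of_nonneg (by positivity)] at hy
  obtain ⟨R₀, -, hR₀⟩ := (hasBasis_cobounded_norm.eventually_iff).1 h1'
  filter_upwards [eventually_cobounded_le_norm (E := E) (max (R₀ + 1) 2)] with x hx
  have hx1 : R₀ + 1 ≤ ‖x‖ := (le_max_left _ _).trans hx
  have hx2 : 2 ≤ ‖x‖ := (le_max_right _ _).trans hx
  have hx0 : x ≠ 0 := by
    rintro rfl
    rw [norm_zero] at hx2
    exact not_lt.2 hx2 two_pos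
  have hxpos : 0 < ‖x‖ := norm_pos_iff.2 hx0
  -- `g` is `C²` near `x`
  have hg1 : ∀ᶠ y in 𝓝 x, DifferentiableAt ℝ (fun y : E ↦ ‖y‖⁻¹ • c) y := by
    filter_upwards [eventually_ne_nhds hx0] with y hy
    exact differentiableAt_inv_norm_smul c hy
  have hg2 : DifferentiableAt ℝ (fderiv ℝ fun y : E ↦ ‖y‖⁻¹ • c) x :=
    differentiableAt_fderiv_inv_norm_smul c hx0
  rcases norm_fderiv_fderiv_add_le_or (f := f) hg1 hg2 with h | h
  · exact h
  · -- the exceptional alternative contradicts `‖Dg(x)‖ = ‖c‖ ‖x‖⁻² > sup ‖Df‖` near `x`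
    exfalso
    have hC : ∀ᶠ y in 𝓝 x, ‖fderiv ℝ f y‖ ≤ ‖c‖ / 2 * (‖x‖ ^ 2)⁻¹ := by
      filter_upwards [Metric.ball_mem_nhds x one_pos] with y hy
      rw [Metric.mem_ball, dist_eq_norm] at hy
      have hy1 : ‖x‖ - 1 ≤ ‖y‖ := by
        have := norm_sub_norm_le x y
        have : ‖x - y‖ = ‖y - x‖ := norm_sub_rev x y
        linarith
      have hyR : R₀ ≤ ‖y‖ := by linarith
      have hy2 : ‖x‖ / 2 ≤ ‖y‖ := by linarith
      have hypos : 0 < ‖x‖ / 2 := by linarith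
      calc ‖fderiv ℝ f y‖ ≤ ‖c‖ / 8 * (‖y‖ ^ 2)⁻¹ := hR₀ hyR
        _ ≤ ‖c‖ / 8 * ((‖x‖ / 2) ^ 2)⁻¹ := by
            gcongr
        _ = ‖c‖ / 2 * (‖x‖ ^ 2)⁻¹ := by
            field_simp
            ring
    have hle := h _ hC
    rw [norm_fderiv_inv_norm_smul c hx0] at hle
    have : (0 : ℝ) < (‖x‖ ^ 2)⁻¹ := by positivity
    nlinarith

/-- **`o₂(r⁻¹)` up to `(1 + a/r) c` is `O₂(r⁻¹)` up to `c`, for junk-valued derivatives.** Let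
`F : E → V` be arbitrary, `a : ℝ`, `c : V`. If `F - (1 + a/r) • c = o_m(r^{-1-m})` for `m ≤ 2` at
infinity, the derivatives being Mathlib's junk-valued `iteratedFDeriv ℝ m` and no smoothness of
`F` being assumed, then `F - c = O_m(r^{-1-m})` for `m ≤ 2` in the same sense (the difference is
`(a/r) • c`, whose `m`-th derivative is `O(r^{-1-m})`). [folklore] -/
theorem isBigO_iteratedFDeriv_sub_of_isLittleO {F : E → V} (a : ℝ) (c : V)
    (hF : ∀ m : ℕ, m ≤ 2 →
      (fun x ↦ ‖iteratedFDeriv ℝ m (fun y ↦ F y - (1 + a / ‖y‖) • c) x‖) =o[cobounded E]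
        fun x ↦ ‖x‖ ^ (-1 - (m : ℝ)))
    (m : ℕ) (hm : m ≤ 2) :
    (fun x ↦ ‖iteratedFDeriv ℝ m (fun y ↦ F y - c) x‖) =O[cobounded E]
      fun x ↦ ‖x‖ ^ (-1 - (m : ℝ)) := by
  have hfg : (fun y ↦ F y - c) =
      (fun y ↦ F y - (1 + a / ‖y‖) • c) + fun y : E ↦ ‖y‖⁻¹ • (a • c) := by
    funext y
    simp only [Pi.add_apply]
    rw [smul_smul, ← div_eq_inv_mul, add_smul, one_smul]
    abel
  rw [hfg]
  set f : E → V := fun y ↦ F y - (1 + a / ‖y‖) • c with hf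
  -- exponents
  have e0 : ∀ x : E, ‖x‖ ^ (-1 - ((0 : ℕ) : ℝ)) = ‖x‖⁻¹ := fun x ↦ by
    rw [Nat.cast_zero, sub_zero, Real.rpow_neg_one]
  have e1 : ∀ x : E, ‖x‖ ^ (-1 - ((1 : ℕ) : ℝ)) = (‖x‖ ^ 2)⁻¹ := fun x ↦ by
    rw [← Real.rpow_natCast, ← Real.rpow_neg (norm_nonneg x)]
    norm_num
  have e2 : ∀ x : E, ‖x‖ ^ (-1 - ((2 : ℕ) : ℝ)) = (‖x‖ ^ 3)⁻¹ := fun x ↦ by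
    rw [← Real.rpow_natCast, ← Real.rpow_neg (norm_nonneg x)]
    norm_num
  -- the hypotheses at `m = 0, 1, 2` in `fderiv` form
  have h0 : (fun x ↦ ‖f x‖) =o[cobounded E] fun x ↦ ‖x‖⁻¹ :=
    (hF 0 (by norm_num)).congr (fun x ↦ norm_iteratedFDeriv_zero) e0
  have h1 : (fun x ↦ ‖fderiv ℝ f x‖) =o[cobounded E] fun x ↦ (‖x‖ ^ 2)⁻¹ :=
    (hF 1 (by norm_num)).congr (fun x ↦ norm_iteratedFDeriv_one (f := f) (x := x)) e1
  have h2 : (fun x ↦ ‖fderiv ℝ (fderiv ℝ f) x‖) =o[cobounded E] fun x ↦ (‖x‖ ^ 3)⁻¹ := by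
    refine (hF 2 (by norm_num)).congr (fun x ↦ ?_) e2
    rw [← norm_iteratedFDeriv_fderiv, norm_iteratedFDeriv_one]
  interval_cases m
  · exact (isBigO_add_inv_norm_smul (a • c) h0).congr
      (fun x ↦ norm_iteratedFDeriv_zero.symm) fun x ↦ (e0 x).symm
  · exact (isBigO_fderiv_add_inv_norm_smul (a • c) h1).congr
      (fun x ↦ (norm_iteratedFDeriv_one _).symm) fun x ↦ (e1 x).symm
  · refine (isBigO_fderiv_fderiv_add_inv_norm_smul (a • c) h1 h2).congr (fun x ↦ ?_)
      fun x ↦ (e2 x).symm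
    rw [← norm_iteratedFDeriv_fderiv, norm_iteratedFDeriv_one]

end InvNorm

/-! ### The pullback of a smooth field of bilinear forms along a smooth map -/

section PullbackSection

variable {EM : Type*} [NormedAddCommGroup EM] [NormedSpace ℝ EM] {HM : Type*}
  [TopologicalSpace HM] {I : ModelWithCorners ℝ EM HM} {M : Type*} [TopologicalSpace M]
  [ChartedSpace HM M] {EN : Type*} [NormedAddCommGroup EN] [NormedSpace ℝ EN] {HN : Type*}
  [TopologicalSpace HN] {I' : ModelWithCorners ℝ EN HN} {N : Type*} [TopologicalSpace N]
  [ChartedSpace HN N] {n : ℕ∞ω}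

/-- **The pullback of a `C^n` field of bilinear forms along a `C^{n+1}` map is `C^n`.** If `B` is
a `C^n` section of the bundle `Hom(TM, Hom(TM, ℝ))` of bilinear forms on the tangent spaces of `M`
(not necessarily a metric: any smooth symmetric or non-symmetric `2`-tensor, e.g. a second
fundamental form `k`) and `f : N → M` is `C^{n+1}`, then `f^* B` (`pullbackBilin f B`,
`(f^* B)_y (v, w) = B_{f y} (df_y v, df_y w)`) is a `C^n` section of `Hom(TN, Hom(TN, ℝ))`. This
is `PseudoRiemannianMetric.contMDiff_pullbackBilin_holds` (file `IsometryProofs`) with the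
metric `g` replaced by an arbitrary smooth section, and the proof is the same: in tangent
coordinates around `y₀` and `f y₀`, `f^* B = Φᵀ (β ∘ f) Φ` with `Φ = Df` read in charts
(`inTangentCoordinates`, `C^n` by `ContMDiffAt.mfderiv_const`) and `β` the coordinate expression
of `B` (`C^n` by `contMDiffAt_bilin_iff`). O'Neill 1983, Ch. 3, Def. 3.9 (pullback of covariant
tensor fields) and Lemma 3.35 ff. [cite: ONeill1983, Ch. 3, Def. 3.9] -/
theorem contMDiff_pullbackBilin_of_contMDiff [IsManifold I' ∞ N] [IsManifold I ∞ M]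
    {f : N → M} (hf : ContMDiff I' I (n + 1) f)
    {B : Π x : M, TangentSpace I x →L[ℝ] TangentSpace I x →L[ℝ] ℝ}
    (hB : ContMDiff I (I.prod 𝓘(ℝ, EM →L[ℝ] EM →L[ℝ] ℝ)) n
      (fun x : M ↦ Bundle.TotalSpace.mk' (EM →L[ℝ] EM →L[ℝ] ℝ)
        (E := fun x : M ↦ TangentSpace I x →L[ℝ] TangentSpace I x →L[ℝ] ℝ) x (B x))) :
    ContMDiff I' (I'.prod 𝓘(ℝ, EN →L[ℝ] EN →L[ℝ] ℝ)) n
      (fun y : N ↦ Bundle.TotalSpace.mk' (EN →L[ℝ] EN →L[ℝ] ℝ)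
        (E := fun y : N ↦ TangentSpace I' y →L[ℝ] TangentSpace I' y →L[ℝ] ℝ) y
        (pullbackBilin (I := I) (I' := I') f B y)) := by
  intro y₀
  rw [contMDiffAt_bilin_iff]
  refine ⟨contMDiffAt_id, ?_⟩
  -- notation: `τN`, `τM` the trivializations of `TN` at `y₀` and of `TM` at `f y₀`
  set τN := trivializationAt EN (TangentSpace I' : N → Type _) y₀ with hτN
  set τM := trivializationAt EM (TangentSpace I : M → Type _) (f y₀) with hτM
  -- `Φ y = τM ∘ Df_y ∘ τN⁻¹` (the derivative read in charts), `C^n` at `y₀`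
  set Φ : N → EN →L[ℝ] EM :=
    inTangentCoordinates I' I _root_.id f (fun y ↦ mfderiv I' I f y) y₀ with hΦ
  have hΦs : ContMDiffAt I' 𝓘(ℝ, EN →L[ℝ] EM) n Φ y₀ :=
    ContMDiffAt.mfderiv_const (hf y₀) le_rfl
  -- `β x = τM⁻ᵀ B_x τM⁻¹` (the field read in the chart at `f y₀`), `C^n` at `f y₀`
  set β : M → EM →L[ℝ] EM →L[ℝ] ℝ := fun x ↦
    (ContinuousLinearMap.precomp ℝ (τM.symmL ℝ x)).comp ((B x).comp (τM.symmL ℝ x)) with hβ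
  have hβs : ContMDiffAt I 𝓘(ℝ, EM →L[ℝ] EM →L[ℝ] ℝ) n β (f y₀) :=
    ((contMDiffAt_bilin_iff (IX := I) (IB := I) (V := (TangentSpace I : M → Type _))
      (b := _root_.id) (s := B) (x₀ := f y₀)).1 (hB (f y₀))).2
  have hf' : ContMDiffAt I' I n f y₀ := (hf y₀).of_le le_self_add
  have hβf : ContMDiffAt I' 𝓘(ℝ, EM →L[ℝ] EM →L[ℝ] ℝ) n (fun y ↦ β (f y)) y₀ :=
    ContMDiffAt.comp y₀ hβs hf'
  -- the composite `y ↦ Φᵀ (β (f y)) Φ` is `C^n` at `y₀`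
  have h1 : ContMDiffAt I' 𝓘(ℝ, EN →L[ℝ] EM →L[ℝ] ℝ) n (fun y ↦ (β (f y)).comp (Φ y)) y₀ :=
    ContMDiffAt.clm_comp hβf hΦs
  have h2 : ContMDiffAt I' 𝓘(ℝ, (EM →L[ℝ] ℝ) →L[ℝ] (EN →L[ℝ] ℝ)) n
      (fun y ↦ (Φ y).precomp ℝ) y₀ :=
    hΦs.clm_precomp (F₃ := ℝ)
  have hcomp : ContMDiffAt I' 𝓘(ℝ, EN →L[ℝ] EN →L[ℝ] ℝ) n
      (fun y ↦ ((Φ y).precomp ℝ).comp ((β (f y)).comp (Φ y))) y₀ :=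
    ContMDiffAt.clm_comp h2 h1
  -- and it agrees with the coordinate expression of `f^* B` near `y₀`
  refine hcomp.congr_of_eventuallyEq ?_
  have hev : ∀ᶠ y in 𝓝 y₀, f y ∈ τM.baseSet :=
    (hf y₀).continuousAt.preimage_mem_nhds
      (τM.open_baseSet.mem_nhds (FiberBundle.mem_baseSet_trivializationAt' (f y₀)))
  filter_upwards [hev] with y hfy
  ext v w
  have key : ∀ u : EN, τM.symmL ℝ (f y) (Φ y u) = mfderiv I' I f y (τN.symmL ℝ y u) := by
    intro u
    simp only [hΦ, inTangentCoordinates, ContinuousLinearMap.inCoordinates,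
      ContinuousLinearMap.coe_comp, Function.comp_apply, id_eq]
    exact τM.symmL_continuousLinearMapAt hfy _
  simp only [ContinuousLinearMap.coe_comp, Function.comp_apply,
    ContinuousLinearMap.precomp_apply, pullbackBilin_apply, hβ, key]
  rfl

end PullbackSection

/-! ### The discharges -/

namespace AFEnd

variable {X : Type*} [TopologicalSpace X] [ChartedSpace E3 X] [IsManifold (𝓡 3) ∞ X]
  (e : AFEnd X) (D : InitialDataSet (𝓡 3) X)

/-- **DR-strong asymptotic flatness implies asymptotic flatness of order `1`** (discharge of the
named fact `IsStronglyAsymptoticallyFlatDR.IsAsymptoticallyFlat_one`): if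
`h_ij = (1 + 2M/r) δ_ij + o₂(r⁻¹)` and `k_ij = o₁(r⁻²)` in the chart of the end, then
`h_ij - δ_ij = O₂(r⁻¹)` and `k_ij = O₁(r⁻²)`, since `(2M/r) δ = O₂(r⁻¹)` — proved here for the
junk-valued `iteratedFDeriv` of the vendored definitions, without any smoothness hypothesis on
the chart components (see the module docstring). Dafermos–Rodnianski 2013, App. B.2.3
(arXiv:0811.0354, §11.2.3, p. 51); Bartnik 1986, Def. 2.1.
[cite: DafermosRodnianski2013, App. B.2.3] -/
theorem IsStronglyAsymptoticallyFlatDR.IsAsymptoticallyFlat_one_holds :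
    IsStronglyAsymptoticallyFlatDR.IsAsymptoticallyFlat_one e D := by
  intro M hM
  refine ⟨fun m hm ↦ ?_, fun m hm ↦ ?_⟩
  · -- the `h` part
    exact isBigO_iteratedFDeriv_sub_of_isLittleO (2 * M) (innerSL ℝ : E3 →L[ℝ] E3 →L[ℝ] ℝ)
      hM.1 m hm
  · -- the `k` part: `o₁(r⁻²)` is `O₁(r⁻²)`
    refine (hM.2 m hm).isBigO.congr_right fun x ↦ ?_
    norm_num

/-- **The chart components of the metric are smooth on the exterior region** (discharge of the
named fact `ContDiffOn_hCoeff`): `x ↦ h_ij(x) = (Φ^* h)_x`, the pullback of the `C^∞` metric `h`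
along the `C^∞` inverse chart `Φ = e.dataChart` of the end, is `C^∞` on `{R < ‖x‖}`. The pullback
is a `C^∞` section of the bundle of bilinear forms over the open submanifold
`exteriorRegion e.R ⊆ E3` (`PseudoRiemannianMetric.contMDiff_pullbackBilin_holds`), and over an
open subset of the model space that bundle is trivialised by the identity, so that the section is
`C^∞` iff its representative `hCoeff e D : E3 → (E3 →L E3 →L ℝ)` is
(`OpensChart.contMDiffAt_bilinSection_iff`). Bartnik, CPAM 39 (1986), §1 (p. 662, the exterior
domain `E_R`) and Def. 2.1 (p. 675, the structure of infinity `Φ` and the components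
`(Φ_* g)_ij`); O'Neill 1983, Ch. 3, Def. 3.9. [cite: Bartnik1986, Def. 2.1 (p. 675)] -/
theorem ContDiffOn_hCoeff_holds : ContDiffOn_hCoeff e D := by
  -- the inverse chart is `C^{∞ + 1} = C^∞`
  have hf : ContMDiff (𝓡 3) (𝓡 3) (∞ + 1) e.dataChart := e.contMDiff_dataChart
  -- the pullback `Φ^* h` is a `C^∞` section of `Hom(TU, Hom(TU, ℝ))`, `U = exteriorRegion e.R`
  have hsec := PseudoRiemannianMetric.contMDiff_pullbackBilin_holds (I := 𝓡 3) (I' := 𝓡 3)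
    (M := X) (N := exteriorRegion e.R) (n := ∞) e.dataChart hf D.metric
  -- its representative `hCoeff e D` agrees with it on `U`
  have hrep : ∀ y : exteriorRegion e.R,
      pullbackBilin (I := 𝓡 3) (I' := 𝓡 3) e.dataChart D.metric.val y = hCoeff e D y := by
    intro y
    rw [hCoeff_of_lt D y.2]
    rfl
  intro x hx
  have hAt : ContDiffAt ℝ ∞ (hCoeff e D) x :=
    (OpensChart.contMDiffAt_bilinSection_iff (U := exteriorRegion e.R) ⟨x, hx⟩ _ (hCoeff e D)
      hrep).1 (hsec ⟨x, hx⟩)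
  exact hAt.contDiffWithinAt

/-- **The chart components of the second fundamental form are smooth on the exterior region**
(discharge of the named fact `ContDiffOn_kCoeff`): `x ↦ k_ij(x) = (Φ^* k)_x`, the pullback of
the `C^∞` symmetric `2`-tensor `k` along the `C^∞` inverse chart `Φ = e.dataChart` of the end, is
`C^∞` on `{R < ‖x‖}` — the pullback is a `C^∞` section of the bundle of bilinear forms over the
open submanifold `exteriorRegion e.R ⊆ E3` (`contMDiff_pullbackBilin_of_contMDiff` applied to
`InitialDataSet.contMDiff_k`), whose representative `kCoeff e D` is therefore `C^∞`
(`OpensChart.contMDiffAt_bilinSection_iff`). Christodoulou–Klainerman 1993, §1, (1.0.9b)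
(`k_ij` read in a coordinate system defined in a neighbourhood of infinity, `g` and `k`
sufficiently smooth); Bartnik 1986, Def. 2.1 (p. 675).
[cite: ChristodoulouKlainerman1993, §1, (1.0.9b)] -/
theorem ContDiffOn_kCoeff_holds : ContDiffOn_kCoeff e D := by
  -- the inverse chart is `C^{∞ + 1} = C^∞`
  have hf : ContMDiff (𝓡 3) (𝓡 3) (∞ + 1) e.dataChart := e.contMDiff_dataChart
  -- the pullback `Φ^* k` is a `C^∞` section of `Hom(TU, Hom(TU, ℝ))`, `U = exteriorRegion e.R`
  have hsec := contMDiff_pullbackBilin_of_contMDiff (I := 𝓡 3) (I' := 𝓡 3) (M := X)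
    (N := exteriorRegion e.R) (n := ∞) hf D.contMDiff_k
  -- its representative `kCoeff e D` agrees with it on `U`
  have hrep : ∀ y : exteriorRegion e.R,
      pullbackBilin (I := 𝓡 3) (I' := 𝓡 3) e.dataChart D.k y = kCoeff e D y := by
    intro y
    rw [kCoeff_of_lt D y.2]
  intro x hx
  have hAt : ContDiffAt ℝ ∞ (kCoeff e D) x :=
    (OpensChart.contMDiffAt_bilinSection_iff (U := exteriorRegion e.R) ⟨x, hx⟩ _ (kCoeff e D)
      hrep).1 (hsec ⟨x, hx⟩)
  exact hAt.contDiffWithinAt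

end AFEnd

end Literature.Geometry.Lorentzian

end
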